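import Literature.NumberTheory.Sieve.LargestPrimeFactorCubicLnuSeries
import HarnessLib

/-!
# Heath-Brown 2001 (PLMS), §7 p. 29: the tail `∑_{d ≥ D} |l(d)ν(d)/d| ≪ D^{-1/4}` (Rankin's trick)

Topic `Literature/NumberTheory/Sieve`; a PROVED analytic layer (one definition with body, no named facts)
under the named fact `Irving2015_largestPrimeFactor_cubic` (`LargestPrimeFactorCubic.lean`), continuing
`…LnuSeries`.  Source: D. R. Heath-Brown, *The largest prime factor of `X³ + 2`*, Proc. London Math. Soc.
(3) 82 (2001) 554–596, §7 p. 29: "if we take `d = ef²`, with `e, f` coprime and square-free, then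
`∑_{d≥D} l(d)ν(d)/d ≪ ∑_{ef²≥D} (ef)^{−2+ε} ≪ … ≪ D^{−1/2+ε} ≪ N^{−δ}`."  We prove the weaker but
sufficient power saving `D^{−1/4}` by Rankin's trick: the weighted function `d^{1/4}|l(d)ν(d)/d|` is
multiplicative and non-negative with local factors `1 + O(p^{−3/2})`, hence has bounded partial sums
(`sum_range_wlnu_le`, via the smooth-number Euler product exactly as `…LnuSeries.sum_range_abs_lnu_le`),
and `∑_{d≥D} |lnu d| ≤ D^{−1/4} ∑_d d^{1/4}|lnu d|` (**`tsum_abs_lnu_tail_le`**).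

## References

* D. R. Heath-Brown, *The largest prime factor of `X³ + 2`*, Proc. London Math. Soc. (3) 82 (2001)
  554–596, §7 p. 29. [`HeathBrown2001LargestPrimeFactorCubic`]

## Mathlib / tree search

Tree: `lnu`, `isMultiplicative_lnu`, `lnu_one`, `lnu_prime_pow_eq_zero`, `abs_lnu_prime_le`,
`abs_lnu_two_three`, `summable_abs_lnu` (`…LnuSeries`).  Mathlib:
`EulerProduct.summable_and_hasSum_smoothNumbers_prod_primesBelow_tsum`, `Real.summable_nat_rpow_inv`,
`Real.add_one_le_exp`, `summable_of_sum_range_le`, `sum_add_tsum_nat_add`.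
-/

noncomputable section

open Finset Real

namespace Literature.NumberTheory.Sieve.HeathBrown2001

/-- The Rankin-weighted function `w(d) = d^{1/4} |l(d)ν(d)/d|`. [cite: HeathBrown2001LargestPrimeFactorCubic, §7 p. 29] -/
def wlnu (d : ℕ) : ℝ := (d : ℝ) ^ ((1 : ℝ) / 4) * |lnu d|

/-- Auxiliary: `wlnu` is non-negative. [folklore] -/
theorem wlnu_nonneg (d : ℕ) : 0 ≤ wlnu d := by unfold wlnu; positivity

/-- Auxiliary: `wlnu 1 = 1`, `wlnu 0 = 0`. [folklore] -/
theorem wlnu_one : wlnu 1 = 1 := by rw [wlnu, lnu_one]; simp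

/-- Auxiliary: multiplicativity on coprime arguments. [folklore] -/
theorem wlnu_mul {m n : ℕ} (hmn : Nat.Coprime m n) : wlnu (m * n) = wlnu m * wlnu n := by
  rw [wlnu, wlnu, wlnu, isMultiplicative_lnu.map_mul_of_coprime hmn, abs_mul, Nat.cast_mul,
    Real.mul_rpow (Nat.cast_nonneg _) (Nat.cast_nonneg _)]
  ring

/-- Auxiliary: `wlnu (p^e) = 0` for `e ≥ 3`. [folklore] -/
theorem wlnu_prime_pow_eq_zero {p : ℕ} (hp : p.Prime) {e : ℕ} (he : 3 ≤ e) : wlnu (p ^ e) = 0 := by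
  rw [wlnu, lnu_prime_pow_eq_zero hp he, abs_zero, mul_zero]

/-- The local terms for `p ≥ 5`: `wlnu p + wlnu p² ≤ 21/p^{3/2}`. [folklore] -/
theorem wlnu_prime_add_le {p : ℕ} (hp : p.Prime) (h5 : 5 ≤ p) :
    wlnu p + wlnu (p ^ 2) ≤ 21 / (p : ℝ) ^ ((3 : ℝ) / 2) := by
  obtain ⟨h1, h2⟩ := abs_lnu_prime_le hp h5
  have hp0 : (0 : ℝ) < p := by exact_mod_cast hp.pos
  have hp1 : (1 : ℝ) ≤ p := by exact_mod_cast hp.one_lt.le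
  -- `p^{1/4} ≤ p^{1/2}` and `p^{1/2} · p^{-2} = p^{-3/2}`
  have hq : ((p : ℝ) ^ 2 : ℝ) ^ ((1 : ℝ) / 4) = (p : ℝ) ^ ((1 : ℝ) / 2) := by
    rw [← Real.rpow_natCast, ← Real.rpow_mul hp0.le]; norm_num
  have h14 : (p : ℝ) ^ ((1 : ℝ) / 4) ≤ (p : ℝ) ^ ((1 : ℝ) / 2) :=
    Real.rpow_le_rpow_of_exponent_le hp1 (by norm_num)
  have hkey : (p : ℝ) ^ ((1 : ℝ) / 2) / (p : ℝ) ^ 2 = 1 / (p : ℝ) ^ ((3 : ℝ) / 2) := by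
    rw [div_eq_div_iff (by positivity) (by positivity), one_mul, ← Real.rpow_natCast,
      ← Real.rpow_add hp0]; norm_num
  unfold wlnu
  push_cast
  rw [hq]
  calc (p : ℝ) ^ ((1 : ℝ) / 4) * |lnu p| + (p : ℝ) ^ ((1 : ℝ) / 2) * |lnu (p ^ 2)|
      ≤ (p : ℝ) ^ ((1 : ℝ) / 2) * (15 / (p : ℝ) ^ 2) + (p : ℝ) ^ ((1 : ℝ) / 2) * (6 / (p : ℝ) ^ 2) := by
        gcongr
    _ = 21 * ((p : ℝ) ^ ((1 : ℝ) / 2) / (p : ℝ) ^ 2) := by ring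
    _ = 21 / (p : ℝ) ^ ((3 : ℝ) / 2) := by rw [hkey]; ring

/-- The local terms at `2, 3`: `wlnu 2 + wlnu 4 + wlnu 3 + wlnu 9 ≤ 3`. [folklore] -/
theorem wlnu_two_three : wlnu 2 + wlnu (2 ^ 2) + (wlnu 3 + wlnu (3 ^ 2)) ≤ 3 := by
  obtain ⟨h2, h4, h3, h9⟩ := abs_lnu_two_three
  unfold wlnu
  rw [h4, h9, abs_zero, mul_zero, mul_zero, add_zero, add_zero]
  -- `2^{1/4} ≤ 2`, `3^{1/4} ≤ 3`; `|lnu 2|, |lnu 3| ≤ 1/3`-ish: use the numerical values from `abs_lnu_two_three`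
  have hb2 : ((2 : ℕ) : ℝ) ^ ((1 : ℝ) / 4) ≤ 3 / 2 := by
    have : ((2 : ℕ) : ℝ) ^ ((1 : ℝ) / 4) ≤ ((81 / 16 : ℝ)) ^ ((1 : ℝ) / 4) :=
      Real.rpow_le_rpow (by norm_num) (by norm_num) (by norm_num)
    rw [show (81 / 16 : ℝ) = (3 / 2) ^ (4 : ℕ) by norm_num, ← Real.rpow_natCast,
      ← Real.rpow_mul (by norm_num)] at this
    norm_num at this
    exact this
  have hb3 : ((3 : ℕ) : ℝ) ^ ((1 : ℝ) / 4) ≤ 3 / 2 := by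
    have : ((3 : ℕ) : ℝ) ^ ((1 : ℝ) / 4) ≤ ((81 / 16 : ℝ)) ^ ((1 : ℝ) / 4) :=
      Real.rpow_le_rpow (by norm_num) (by norm_num) (by norm_num)
    rw [show (81 / 16 : ℝ) = (3 / 2) ^ (4 : ℕ) by norm_num, ← Real.rpow_natCast,
      ← Real.rpow_mul (by norm_num)] at this
    norm_num at this
    exact this
  have ha2 := abs_nonneg (lnu 2)
  have ha3 := abs_nonneg (lnu 3)
  nlinarith [mul_le_mul_of_nonneg_right hb2 ha2, mul_le_mul_of_nonneg_right hb3 ha3]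

/-- `Z = ∑_n n^{-3/2}` (a finite constant). [folklore] -/
def zeta32 : ℝ := ∑' n : ℕ, 1 / (n : ℝ) ^ ((3 : ℝ) / 2)

/-- Auxiliary fact `summable_inv_rpow32` for this file's estimates. [folklore] -/
theorem summable_inv_rpow32 : Summable fun n : ℕ => 1 / (n : ℝ) ^ ((3 : ℝ) / 2) := by
  have := Real.summable_one_div_nat_rpow.mpr (by norm_num : (1 : ℝ) < 3 / 2)
  exact this

/-- `∑_{p<N} (wlnu p + wlnu p²) ≤ 3 + 21 Z`. [folklore] -/
theorem sum_primesBelow_wlnu_le (N : ℕ) :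
    ∑ p ∈ Nat.primesBelow N, (wlnu p + wlnu (p ^ 2)) ≤ 3 + 21 * zeta32 := by
  classical
  have hsplit := Finset.sum_filter_add_sum_filter_not (Nat.primesBelow N) (fun p => p < 5)
    (fun p => wlnu p + wlnu (p ^ 2))
  rw [← hsplit]
  have h1 : ∑ p ∈ (Nat.primesBelow N).filter (fun p => p < 5), (wlnu p + wlnu (p ^ 2)) ≤ 3 := by
    have hsub : (Nat.primesBelow N).filter (fun p => p < 5) ⊆ {2, 3} := by
      intro p hp
      rw [Finset.mem_filter, Nat.mem_primesBelow] at hp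
      obtain ⟨⟨-, hpP⟩, hp5⟩ := hp
      have := hpP.two_le
      interval_cases p
      · simp
      · simp
      · exact absurd hpP (by decide)
    calc ∑ p ∈ (Nat.primesBelow N).filter (fun p => p < 5), (wlnu p + wlnu (p ^ 2))
        ≤ ∑ p ∈ ({2, 3} : Finset ℕ), (wlnu p + wlnu (p ^ 2)) :=
          Finset.sum_le_sum_of_subset_of_nonneg hsub fun p _ _ => by
            have := wlnu_nonneg p; have := wlnu_nonneg (p ^ 2); positivity
      _ ≤ 3 := by rw [Finset.sum_pair (by norm_num)]; exact wlnu_two_three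
  have h2 : ∑ p ∈ (Nat.primesBelow N).filter (fun p => ¬ p < 5), (wlnu p + wlnu (p ^ 2)) ≤ 21 * zeta32 := by
    calc ∑ p ∈ (Nat.primesBelow N).filter (fun p => ¬ p < 5), (wlnu p + wlnu (p ^ 2))
        ≤ ∑ p ∈ (Nat.primesBelow N).filter (fun p => ¬ p < 5), 21 * (1 / (p : ℝ) ^ ((3 : ℝ) / 2)) := by
          refine Finset.sum_le_sum fun p hp => ?_
          rw [Finset.mem_filter, Nat.mem_primesBelow, not_lt] at hp
          have := wlnu_prime_add_le hp.1.2 hp.2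
          rw [← mul_one_div]  at this
          exact this
      _ = 21 * ∑ p ∈ (Nat.primesBelow N).filter (fun p => ¬ p < 5), 1 / (p : ℝ) ^ ((3 : ℝ) / 2) := by
          rw [Finset.mul_sum]
      _ ≤ 21 * zeta32 := by
          gcongr
          exact summable_inv_rpow32.sum_le_tsum _ (fun n _ => by positivity)
  linarith

/-- The local Euler factor: `∑_e wlnu(p^e) = 1 + wlnu p + wlnu p²`. [folklore] -/
theorem tsum_wlnu_prime_pow {p : ℕ} (hp : p.Prime) :
    ∑' e : ℕ, wlnu (p ^ e) = 1 + wlnu p + wlnu (p ^ 2) := by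
  rw [tsum_eq_sum (s := Finset.range 3) (fun e he => ?_)]
  · rw [Finset.sum_range_succ, Finset.sum_range_succ, Finset.sum_range_one, pow_zero, wlnu_one, pow_one]
  · rw [Finset.mem_range, not_lt] at he
    exact wlnu_prime_pow_eq_zero hp he

/-- The Rankin constant `W = exp(3 + 21 Z)`. [folklore] -/
def rankinW : ℝ := Real.exp (3 + 21 * zeta32)

/-- Auxiliary fact `rankinW_pos` for this file's estimates. [folklore] -/
theorem rankinW_pos : 0 < rankinW := Real.exp_pos _

/-- **Bounded weighted partial sums**: `∑_{d<N} d^{1/4}|lnu d| ≤ W`. [cite: HeathBrown2001LargestPrimeFactorCubic, §7 p. 29] -/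
theorem sum_range_wlnu_le (N : ℕ) : ∑ d ∈ Finset.range N, wlnu d ≤ rankinW := by
  classical
  have hloc : ∀ {p : ℕ}, p.Prime → Summable (fun e : ℕ => ‖wlnu (p ^ e)‖) := by
    intro p hp
    refine summable_of_ne_finset_zero (s := Finset.range 3) fun e he => ?_
    rw [Finset.mem_range, not_lt] at he
    rw [wlnu_prime_pow_eq_zero hp he]; simp
  have h := (EulerProduct.summable_and_hasSum_smoothNumbers_prod_primesBelow_tsum
    (f := fun d : ℕ => wlnu d) wlnu_one (fun hmn => wlnu_mul hmn) hloc N).2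
  have h' : HasSum ((fun d : ℕ => wlnu d) ∘ (Subtype.val : N.smoothNumbers → ℕ))
      (∏ p ∈ N.primesBelow, ∑' e : ℕ, wlnu (p ^ e)) := h
  rw [hasSum_subtype_iff_indicator] at h'
  have hle : ∑ d ∈ Finset.range N, wlnu d ≤ ∏ p ∈ N.primesBelow, ∑' e : ℕ, wlnu (p ^ e) := by
    have heq : ∑ d ∈ Finset.range N, wlnu d =
        ∑ d ∈ Finset.range N, (N.smoothNumbers).indicator (fun d : ℕ => wlnu d) d := by
      refine Finset.sum_congr rfl fun d hd => ?_
      rw [Finset.mem_range] at hd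
      rcases Nat.eq_zero_or_pos d with rfl | hd0
      · simp [Set.indicator_apply, wlnu]
      · rw [Set.indicator_of_mem (Nat.mem_smoothNumbers_of_lt hd0 hd)]
    rw [heq]
    exact sum_le_hasSum _ (fun d _ => Set.indicator_nonneg (fun _ _ => wlnu_nonneg _) _) h'
  refine hle.trans ?_
  calc ∏ p ∈ N.primesBelow, ∑' e : ℕ, wlnu (p ^ e) = ∏ p ∈ N.primesBelow, (1 + (wlnu p + wlnu (p ^ 2))) := by
        refine Finset.prod_congr rfl fun p hp => ?_
        rw [tsum_wlnu_prime_pow (Nat.prime_of_mem_primesBelow hp), add_assoc]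
    _ ≤ ∏ p ∈ N.primesBelow, Real.exp (wlnu p + wlnu (p ^ 2)) := by
        refine Finset.prod_le_prod (fun p _ => by have := wlnu_nonneg p; have := wlnu_nonneg (p^2); positivity)
          fun p _ => ?_
        have := Real.add_one_le_exp (wlnu p + wlnu (p ^ 2)); linarith
    _ = Real.exp (∑ p ∈ N.primesBelow, (wlnu p + wlnu (p ^ 2))) := by rw [Real.exp_sum]
    _ ≤ rankinW := Real.exp_le_exp.mpr (sum_primesBelow_wlnu_le N)

/-- Hence `∑_d d^{1/4}|lnu d|` converges, with sum `≤ W`. [folklore] -/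
theorem summable_wlnu : Summable wlnu :=
  summable_of_sum_range_le wlnu_nonneg sum_range_wlnu_le

/-- **The tail**: `∑_{n} |lnu (n + D)| ≤ W / D^{1/4}` for `D ≥ 1` (so `∑_{d ≥ D} |l(d)ν(d)/d| ≪ D^{-1/4}`).
[cite: HeathBrown2001LargestPrimeFactorCubic, §7 p. 29] -/
theorem tsum_abs_lnu_tail_le {D : ℕ} (hD : 1 ≤ D) :
    Summable (fun n : ℕ => |lnu (n + D)|) ∧ ∑' n : ℕ, |lnu (n + D)| ≤ rankinW / (D : ℝ) ^ ((1 : ℝ) / 4) := by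
  have hs : Summable (fun n : ℕ => |lnu (n + D)|) :=
    (summable_nat_add_iff (f := fun d : ℕ => |lnu d|) D).mpr summable_abs_lnu
  refine ⟨hs, ?_⟩
  have hD0 : (0 : ℝ) < (D : ℝ) ^ ((1 : ℝ) / 4) := Real.rpow_pos_of_pos (by exact_mod_cast hD) _
  -- termwise: `|lnu (n+D)| ≤ D^{-1/4} wlnu (n + D)`
  have hterm : ∀ n : ℕ, |lnu (n + D)| ≤ (1 / (D : ℝ) ^ ((1 : ℝ) / 4)) * wlnu (n + D) := by
    intro n
    have hle : (D : ℝ) ^ ((1 : ℝ) / 4) ≤ ((n + D : ℕ) : ℝ) ^ ((1 : ℝ) / 4) :=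
      Real.rpow_le_rpow (Nat.cast_nonneg _) (by exact_mod_cast Nat.le_add_left D n) (by norm_num)
    rw [wlnu, one_div, ← mul_assoc]
    have h1 : 1 ≤ ((D : ℝ) ^ ((1 : ℝ) / 4))⁻¹ * ((n + D : ℕ) : ℝ) ^ ((1 : ℝ) / 4) := by
      rw [inv_mul_eq_div, le_div_iff₀ hD0, one_mul]; exact hle
    calc |lnu (n + D)| = 1 * |lnu (n + D)| := (one_mul _).symm
      _ ≤ ((D : ℝ) ^ ((1 : ℝ) / 4))⁻¹ * ((n + D : ℕ) : ℝ) ^ ((1 : ℝ) / 4) * |lnu (n + D)| :=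
          mul_le_mul_of_nonneg_right h1 (abs_nonneg _)
  have hsw : Summable (fun n : ℕ => (1 / (D : ℝ) ^ ((1 : ℝ) / 4)) * wlnu (n + D)) :=
    ((summable_nat_add_iff (f := wlnu) D).mpr summable_wlnu).mul_left _
  calc ∑' n : ℕ, |lnu (n + D)| ≤ ∑' n : ℕ, (1 / (D : ℝ) ^ ((1 : ℝ) / 4)) * wlnu (n + D) :=
        Summable.tsum_le_tsum hterm hs hsw
    _ = (1 / (D : ℝ) ^ ((1 : ℝ) / 4)) * ∑' n : ℕ, wlnu (n + D) := tsum_mul_left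
    _ ≤ (1 / (D : ℝ) ^ ((1 : ℝ) / 4)) * rankinW := by
        refine mul_le_mul_of_nonneg_left ?_ (by positivity)
        calc ∑' n : ℕ, wlnu (n + D) ≤ ∑' n : ℕ, wlnu n :=
              (summable_nat_add_iff (f := wlnu) D |>.mpr summable_wlnu).tsum_le_tsum_of_inj _
                (add_left_injective D) (fun n _ => wlnu_nonneg n) (fun _ => le_rfl) summable_wlnu
          _ ≤ rankinW := summable_wlnu.tsum_le_of_sum_range_le sum_range_wlnu_le
    _ = rankinW / (D : ℝ) ^ ((1 : ℝ) / 4) := by ring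

end Literature.NumberTheory.Sieve.HeathBrown2001
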